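import Mathlib
import HarnessLib
import Literature.AlgebraicGeometry.Resolution.CobordantBlowupFiltration

/-!
# S1a — tool: positive pieces of a weighted filtration lie in the ideal of the centre

[OURS · L1 W4.5c · lead-1 g13; folklore] — NOT a statement of the manuscript; counted 0. Used by the leaves of the D₄ kill tree (closedness sections pulled back
along a move have values in `𝒥₁ ≤ (f₀, …, f_{c−1})`).
-/

set_option linter.dupNamespace false

noncomputable section

open Literature.AlgebraicGeometry.Resolution

namespace Summit.ResolutionOfSingularities.ResolutionOfSingularities.Theorems.WildQuotientResolution.S1.KillCert.D4

/-- **`𝒥ₙ ≤ (f₀, …, f_{c−1})` for `n ≥ 1`**: a monomial of positive weight is divisible by some generator. [folklore] -/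
theorem weightedFiltration_ideal_le_span {A : Type} [CommRing A] {c : ℕ} (f : Fin c → A) (w : Fin c → ℕ) {n : ℕ} (hn : 1 ≤ n) :
    (weightedFiltration f w).ideal n ≤ Ideal.span (Set.range f) := by
  rw [weightedFiltration_ideal]
  refine Ideal.span_le.mpr ?_
  rintro _ ⟨α, hα, rfl⟩
  have hα0 : α ≠ 0 := by
    rintro rfl
    simp at hα
    omega
  obtain ⟨i, hi⟩ := Finsupp.support_nonempty_iff.mpr hα0
  rw [← Finsupp.mul_prod_erase α i _ hi]
  refine Ideal.mul_mem_right _ _ (Ideal.pow_mem_of_mem _ (Ideal.subset_span (Set.mem_range_self i)) _ ?_)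
  exact Nat.pos_of_ne_zero (Finsupp.mem_support_iff.mp hi)

end Summit.ResolutionOfSingularities.ResolutionOfSingularities.Theorems.WildQuotientResolution.S1.KillCert.D4

end
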